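import Mathlib.RingTheory.Polynomial.GaussLemma
import Mathlib.LinearAlgebra.FiniteDimensional.Lemmas
import Mathlib.FieldTheory.PrimitiveElement
import Mathlib.RingTheory.Polynomial.Resultant.Basic
import Mathlib.LinearAlgebra.Lagrange
import Mathlib.FieldTheory.IsAlgClosed.AlgebraicClosure
import Literature.Computability.Complexity.NumberFieldIsomorphism
import Literature.Computability.Complexity.ReductionsProofs
import Literature.Computability.Complexity.StringCopy
import HarnessLib

/-!
# Number field isomorphism in `P`: the mathematics of the test, and the irreducibility corollary

Sibling proofs file of `NumberFieldIsomorphism.lean` (facts `lll_monicIrreducible_mem_P`,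
`lenstra_numberFieldIso_mem_P`). It proves, sorry-free and without new facts, the complete
MATHEMATICAL content of the polynomial-time isomorphism test behind `lenstra_numberFieldIso_mem_P`
(A. K. Lenstra 1983, Thm. (3.7); Landau 1985, Thm. 2.1 and its isomorphism corollary; Cohen 1993,
Prop. 4.5.3 / Alg. 4.5.4 run through Trager's norm method, Alg. 3.6.4), leaving to the discharge only
the MACHINE (a `TM2`/`FP` realisation of: integer resultants, interpolation, the squarefree test and —
the part that is the content of the sibling fact `lll_monicIrreducible_mem_P` — factoring in `ℤ[X]`
by [LLL82, §3] on top of the tree's `LLLMachine.lllMachineF_mem_FP`).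

* **`MONIRR ≤ₚ NFISO`** by the diagonal `u ↦ ⟨u, u⟩` (`copyFn`): hence
  `lenstra_numberFieldIso_mem_P → lll_monicIrreducible_mem_P`
  (`lll_monicIrreducible_mem_P_of_lenstra_numberFieldIso_mem_P`) — every decider of `NFISO` contains
  an irreducibility test over `ℤ`, so the isomorphism fact is at least as strong as the LLL
  irreducibility fact of the same file.
* **Cohen Prop. 4.5.3 / §4.5.4** (`nfIsomorphic_iff`): for monic irreducible `p, q ∈ ℤ[X]`,
  `ℚ[X]/(p) ≃ₐ[ℚ] ℚ[X]/(q) ↔ deg p = deg q ∧ p has a root in ℚ[X]/(q)`.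
* **Trager's criterion** (`exists_mem_adjoin_root_iff_exists_irreducible_dvd`, over any field `F`):
  if `N ∈ F[X]` is, over a field `E` splitting `Q`, a constant times `∏_{P(a)=0,Q(b)=0} (X − (a + c b))`
  and is separable, then some root of `P` lies in some `F(b)` iff `N` has an irreducible factor of
  degree `≤ deg Q`; the key step is the primitive-element gcd argument with an explicit good
  multiplier (`mem_adjoin_simple_add_smul`: `F(a + c b) ∋ b`).
* **The test in integer terms**: with `N ∈ ℤ[X]` of degree `≤ deg p · deg q` interpolating the
  integer resultants `Res_Y(q(Y), p(x₀ − cY))`, `x₀ = 0, …, deg p · deg q`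
  (`algebraMap_resultant_comp_eq_prod_pairSums`, `map_eq_prod_pairSums_of_eval_eq_resultant`):
  soundness `nfIsomorphic_iff_of_norm_values` — if `N` is squarefree over `ℚ` then
  `NFIsomorphic p q ↔ deg p = deg q ∧ N has an irreducible ℚ-factor of degree ≤ deg q` — and
  completeness of the multiplier search `exists_multiplier_norm_separable` — some
  `c ≤ (deg p · deg q)²` gives a squarefree `N` (`exists_nodup_pairSums`, `separable_iff_nodup_pairSums`).

## References

* A. K. Lenstra, *Factoring polynomials over algebraic number fields*, EUROCAL '83, LNCS 162
  (1983) 245–254 = report IW 213/82, Thm. (3.7) [Lenstra1983].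
* S. Landau, *Factoring polynomials over algebraic number fields*, SIAM J. Comput. 14 (1985)
  184–195, §1 (Thm. 1.4–1.5: norms), Thm. 2.1 and Cor. (isomorphism of number fields in polynomial
  time) [Landau1985].
* B. M. Trager, *Algebraic factoring and rational function integration*, Proc. SYMSAC '76, 219–226.
* H. Cohen, *A Course in Computational Algebraic Number Theory*, GTM 138, Springer 1993, §3.6.2
  (Lemma 3.6.2, Alg. 3.6.4), Prop. 4.5.3, Alg. 4.5.4, §4.5.4 [Cohen1993].
* A. K. Lenstra, H. W. Lenstra, L. Lovász, *Factoring polynomials with rational coefficients*,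
  Math. Ann. 261 (1982) 515–534, §3 [LenstraLenstraLovasz1982].
* S. Arora, B. Barak, *Computational Complexity: A Modern Approach*, CUP 2009, Thm. 2.8
  (closure of `P` under polynomial-time reductions) [AroraBarak2009].
-/

namespace Literature.Computability.Complexity

open _root_.Computability Polynomial

/-! ### `MONIRR ≤ₚ NFISO`: the irreducibility fact is a corollary of the isomorphism fact -/

/-- The diagonal string `⟨u, u⟩` is in `NFISO` iff `u` reads as a monic irreducible integer
polynomial (a number field is isomorphic to itself). [cite: Cohen1993, §4.5.4 (field isomorphism problem)] -/
theorem boolPair_self_mem_NFIsoLang_iff (u : List Bool) :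
    boolPair u u ∈ NFIsoLang ↔ u ∈ MonicIrreducibleLang := by
  constructor
  · rintro ⟨u', v', p, q, hw, hp, -, hpm, hpi, -, -, -⟩
    have huv : (u, u) = (u', v') := boolPair_injective hw
    obtain ⟨rfl, -⟩ := Prod.mk.inj huv
    exact ⟨p, hp, hpm, hpi⟩
  · rintro ⟨p, hp, hpm, hpi⟩
    exact ⟨u, u, p, p, rfl, hp, hp, hpm, hpi, hpm, hpi, ⟨AlgEquiv.refl⟩⟩

/-- `MONIRR` is the preimage of `NFISO` under the polynomial-time copy map `u ↦ ⟨u, u⟩`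
(`copyFn`). [cite: AroraBarak2009, Thm. 2.8 (polynomial-time Karp reductions)] -/
theorem monicIrreducibleLang_eq_preimage_copyFn :
    MonicIrreducibleLang = copyFn ⁻¹' NFIsoLang := by
  ext u
  change u ∈ MonicIrreducibleLang ↔ copyFn u ∈ NFIsoLang
  rw [copyFn_apply, boolPair_self_mem_NFIsoLang_iff]

/-- **The isomorphism fact implies the irreducibility fact**: `NFISO ∈ P → MONIRR ∈ P`, by the
diagonal reduction `u ↦ ⟨u, u⟩` and closure of `P` under polynomial-time preimages
(`preimage_mem_P`). Any polynomial-time decider of number-field isomorphism (Lenstra 1983,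
Thm. (3.7); Landau 1985) in particular tests irreducibility over `ℤ` in polynomial time
([LLL82, §3]). [cite: Lenstra1983, Thm. 3.7] [cite: AroraBarak2009, Thm. 2.8] -/
theorem lll_monicIrreducible_mem_P_of_lenstra_numberFieldIso_mem_P
    (h : lenstra_numberFieldIso_mem_P) : lll_monicIrreducible_mem_P := by
  unfold lll_monicIrreducible_mem_P
  rw [monicIrreducibleLang_eq_preimage_copyFn]
  exact preimage_mem_P h copyFn_mem_FP

/-! ### Cohen Prop. 4.5.3 / §4.5.4: isomorphism = equal degrees and a root -/

section Algebra

variable {p q : ℤ[X]}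

/-- Gauss: a monic irreducible integer polynomial stays irreducible over `ℚ`.
[cite: Cohen1993, §3.5.5 (factoring over ℤ vs ℚ)] -/
theorem irreducible_map_rat_of_monic (hp : p.Monic) (hpi : Irreducible p) :
    Irreducible (p.map (Int.castRingHom ℚ)) :=
  (IsPrimitive.Int.irreducible_iff_irreducible_map_cast hp.isPrimitive).1 hpi

/-- `[ℚ[X]/(p) : ℚ] = deg p` for monic `p ∈ ℤ[X]`. [cite: Cohen1993, §4.1 (degree of ℚ(θ))] -/
theorem finrank_adjoinRoot_map_rat (hp : p.Monic) :
    Module.finrank ℚ (AdjoinRoot (p.map (Int.castRingHom ℚ))) = p.natDegree := by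
  rw [(AdjoinRoot.powerBasis' (hp.map (Int.castRingHom ℚ))).finrank,
    AdjoinRoot.powerBasis'_dim, hp.natDegree_map]

/-- Isomorphic number fields have defining polynomials of the same degree.
[cite: Cohen1993, §4.5.4 (isomorphism ⇒ same degree)] -/
theorem NFIsomorphic.natDegree_eq (hp : p.Monic) (hq : q.Monic) (h : NFIsomorphic p q) :
    p.natDegree = q.natDegree := by
  obtain ⟨e⟩ := h
  rw [← finrank_adjoinRoot_map_rat hp, ← finrank_adjoinRoot_map_rat hq]
  exact e.toLinearEquiv.finrank_eq

/-- An isomorphism `ℚ[X]/(p) ≃ ℚ[X]/(q)` carries the class of `X` to a root of `p` in `ℚ[X]/(q)`.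
[cite: Cohen1993, Prop. 4.5.3 (⇒)] -/
theorem NFIsomorphic.exists_aeval_eq_zero (h : NFIsomorphic p q) :
    ∃ x : AdjoinRoot (q.map (Int.castRingHom ℚ)), aeval x (p.map (Int.castRingHom ℚ)) = 0 := by
  obtain ⟨e⟩ := h
  refine ⟨e (AdjoinRoot.root _), ?_⟩
  have h0 := AdjoinRoot.aeval_algHom_eq_zero (p.map (Int.castRingHom ℚ)) e.toAlgHom
  simpa using h0

/-- **Cohen Prop. 4.5.3 with §4.5.4 (⇐)**: if `p, q ∈ ℤ[X]` are monic irreducible of the same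
degree and `p` has a root `x` in `L = ℚ[X]/(q)`, then `ℚ[X]/(p) ≃ₐ[ℚ] L` — the embedding
`X ↦ x` of the field `ℚ[X]/(p)` is injective, hence bijective by equality of the (finite)
`ℚ`-dimensions. [cite: Cohen1993, Prop. 4.5.3 and §4.5.4 (PDF pp. 230–232)] -/
theorem nfIsomorphic_of_natDegree_eq_of_aeval_eq_zero (hp : p.Monic) (hpi : Irreducible p)
    (hq : q.Monic) (hqi : Irreducible q) (hdeg : p.natDegree = q.natDegree)
    {x : AdjoinRoot (q.map (Int.castRingHom ℚ))} (hx : aeval x (p.map (Int.castRingHom ℚ)) = 0) :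
    NFIsomorphic p q := by
  haveI hP : Fact (Irreducible (p.map (Int.castRingHom ℚ))) := ⟨irreducible_map_rat_of_monic hp hpi⟩
  haveI hQ : Fact (Irreducible (q.map (Int.castRingHom ℚ))) := ⟨irreducible_map_rat_of_monic hq hqi⟩
  haveI : Module.Finite ℚ (AdjoinRoot (p.map (Int.castRingHom ℚ))) :=
    (hp.map (Int.castRingHom ℚ)).finite_adjoinRoot
  haveI : Module.Finite ℚ (AdjoinRoot (q.map (Int.castRingHom ℚ))) :=
    (hq.map (Int.castRingHom ℚ)).finite_adjoinRoot
  let φ : AdjoinRoot (p.map (Int.castRingHom ℚ)) →ₐ[ℚ] AdjoinRoot (q.map (Int.castRingHom ℚ)) :=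
    AdjoinRoot.liftAlgHom (p.map (Int.castRingHom ℚ)) (Algebra.ofId ℚ _) x
      (by rwa [aeval_def] at hx)
  have hinj : Function.Injective φ := φ.toRingHom.injective
  have hfin : Module.finrank ℚ (AdjoinRoot (p.map (Int.castRingHom ℚ))) =
      Module.finrank ℚ (AdjoinRoot (q.map (Int.castRingHom ℚ))) := by
    rw [finrank_adjoinRoot_map_rat hp, finrank_adjoinRoot_map_rat hq, hdeg]
  have hsurj : Function.Surjective φ :=
    (LinearMap.injective_iff_surjective_of_finrank_eq_finrank hfin (f := φ.toLinearMap)).1 hinj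
  exact ⟨AlgEquiv.ofBijective φ ⟨hinj, hsurj⟩⟩

/-- **Cohen Prop. 4.5.3 + §4.5.4 — the criterion decided by the number-field isomorphism test**:
for monic irreducible `p, q ∈ ℤ[X]`, the fields `ℚ[X]/(p)` and `ℚ[X]/(q)` are `ℚ`-isomorphic iff
`deg p = deg q` and `p` has a root in `ℚ[X]/(q)` (i.e. a linear factor over `ℚ(β)`, found in
polynomial time by Lenstra 1983 Thm. (3.7) / Landau 1985). [cite: Cohen1993, Prop. 4.5.3, Alg. 4.5.4 and §4.5.4 (PDF pp. 230–232)] [cite: Lenstra1983, Thm. 3.7] -/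
theorem nfIsomorphic_iff (hp : p.Monic) (hpi : Irreducible p) (hq : q.Monic) (hqi : Irreducible q) :
    NFIsomorphic p q ↔ p.natDegree = q.natDegree ∧
      ∃ x : AdjoinRoot (q.map (Int.castRingHom ℚ)), aeval x (p.map (Int.castRingHom ℚ)) = 0 :=
  ⟨fun h => ⟨h.natDegree_eq hp hq, h.exists_aeval_eq_zero⟩,
    fun h => h.2.elim fun _ hx => nfIsomorphic_of_natDegree_eq_of_aeval_eq_zero hp hpi hq hqi h.1 hx⟩

/-- `NFIsomorphic` is symmetric. [folklore] -/
theorem NFIsomorphic.symm (h : NFIsomorphic p q) : NFIsomorphic q p :=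
  h.elim fun e => ⟨e.symm⟩

/-- `NFIsomorphic` is reflexive. [folklore] -/
theorem NFIsomorphic.refl (p : ℤ[X]) : NFIsomorphic p p := ⟨AlgEquiv.refl⟩

/-- `NFIsomorphic` is transitive. [folklore] -/
theorem NFIsomorphic.trans {r : ℤ[X]} (h₁ : NFIsomorphic p q) (h₂ : NFIsomorphic q r) :
    NFIsomorphic p r :=
  h₁.elim fun e₁ => h₂.elim fun e₂ => ⟨e₁.trans e₂⟩

end Algebra

/-! ### Trager's criterion (Landau 1985, §1; Cohen 1993, §3.6.2): roots of `P` in `F(β)` and the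
small irreducible factors of the norm polynomial `N_c = ∏ᵢⱼ (X − (αᵢ + c βⱼ))` -/

section Trager

variable {F E : Type*} [Field F] [Field E] [Algebra F E]

open IntermediateField in
/-- **Primitive element with an explicit good multiplier** (the gcd argument of the primitive
element theorem, Mathlib's `Field.primitive_element_inf_aux`, with the generic choice of `c`
replaced by the hypothesis that makes it work): if `α` is a root of `f ≠ 0`, `β` a root of the
separable polynomial `g` which splits in `E`, and no root `α'` of `f` and root `β'` of `g` other
than `β' = β` satisfy `α' + c β' = α + c β`, then `β ∈ F(α + c β)` — indeed
`gcd (f(γ − cX), g(X)) = X − β` over `F(γ)`, `γ = α + c β` (van der Waerden's proof of the primitive element theorem; the collision condition is the one of Cohen 1993, proof of Lemma 3.6.2, PDF p. 194). [cite: Cohen1993, §3.6.2 (proof of Lemma 3.6.2, PDF p. 194)] -/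
theorem mem_adjoin_simple_add_smul {f g : F[X]} {α β : E} (hf0 : f ≠ 0)
    (hα : aeval α f = 0) (hβ : aeval β g = 0) (hgsep : g.Separable)
    (hgs : (g.map (algebraMap F E)).Splits) (c : F)
    (hc : ∀ α' ∈ f.aroots E, ∀ β' ∈ g.aroots E, α' + c • β' = α + c • β → β' = β) :
    β ∈ F⟮α + c • β⟯ := by
  classical
  have hg0 : g ≠ 0 := hgsep.ne_zero
  let ιFE := algebraMap F E
  let γ := α + c • β
  show β ∈ F⟮γ⟯
  let P := EuclideanDomain.gcd ((f.map (algebraMap F F⟮γ⟯)).comp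
    (C (AdjoinSimple.gen F γ) - (C ↑c : F⟮γ⟯[X]) * X)) (g.map (algebraMap F F⟮γ⟯))
  let h := EuclideanDomain.gcd ((f.map ιFE).comp (C γ - C (ιFE c) * X)) (g.map ιFE)
  have map_g_ne_zero : g.map ιFE ≠ 0 := map_ne_zero hg0
  have h_ne_zero : h ≠ 0 :=
    mt EuclideanDomain.gcd_eq_zero_iff.mp (not_and.mpr fun _ => map_g_ne_zero)
  suffices p_linear : P.map (algebraMap F⟮γ⟯ E) = C h.leadingCoeff * (X - C β) by
    have finale : β = algebraMap F⟮γ⟯ E (-P.coeff 0 / P.coeff 1) := by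
      simp [map_div₀, map_neg, ← coeff_map, ← coeff_map, p_linear,
        mul_sub, coeff_C, mul_div_cancel_left₀ β (mt leadingCoeff_eq_zero.mp h_ne_zero)]
    rw [finale]
    exact Subtype.mem (-P.coeff 0 / P.coeff 1)
  have h_sep : h.Separable := separable_gcd_right _ hgsep.map
  have h_root : h.eval β = 0 := by
    apply eval_gcd_eq_zero
    · rw [eval_comp, eval_sub, eval_mul, eval_C, eval_C, eval_X, eval_map_algebraMap, ←
        Algebra.smul_def, add_sub_cancel_right, hα]
    · rw [eval_map_algebraMap, hβ]
  have h_splits : Splits (h.map (RingHom.id E)) := by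
    rw [Polynomial.map_id]
    exact hgs.of_dvd map_g_ne_zero (EuclideanDomain.gcd_dvd_right _ _)
  have h_roots : ∀ x ∈ (h.map (RingHom.id E)).roots, x = (RingHom.id E) β := by
    intro x hx
    rw [mem_roots_map h_ne_zero] at hx
    have f_root := root_left_of_root_gcd hx
    have g_root := root_right_of_root_gcd hx
    rw [eval₂_comp, eval₂_sub, eval₂_mul, eval₂_C, eval₂_C, eval₂_X, eval₂_map] at f_root
    rw [eval₂_map] at g_root
    have hα' : γ - c • x ∈ f.aroots E := by
      rw [mem_aroots]
      refine ⟨hf0, ?_⟩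
      rw [Algebra.smul_def]
      exact f_root
    have hβ' : x ∈ g.aroots E := by
      rw [mem_aroots]
      exact ⟨hg0, g_root⟩
    exact hc (γ - c • x) hα' x hβ' (sub_add_cancel γ (c • x))
  rw [← eq_X_sub_C_of_separable_of_root_eq h_sep h_root h_splits h_roots]
  trans EuclideanDomain.gcd (?_ : E[X]) (?_ : E[X])
  · dsimp only [γ]
    convert! (gcd_map (algebraMap F⟮γ⟯ E)).symm
  · simp only [map_comp, Polynomial.map_map, ← IsScalarTower.algebraMap_eq, Polynomial.map_sub,
      map_C, AdjoinSimple.algebraMap_gen, Polynomial.map_mul, map_X]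
    congr

open IntermediateField in
/-- **Roots in `F[X]/(Q)` = roots in `F(b)`** (Cohen 1993, Prop. 4.5.3, read in a big field): for
`Q` monic irreducible with a root in `E`, the polynomial `P ≠ 0` has a root in the field `F[X]/(Q)`
iff some root `a ∈ E` of `P` lies in `F(b)` for some root `b ∈ E` of `Q` (all the `F(b)` being
`F`-isomorphic to `F[X]/(Q)`). [cite: Cohen1993, Prop. 4.5.3 (PDF p. 230)] -/
theorem exists_aeval_adjoinRoot_eq_zero_iff {P Q : F[X]} (hP0 : P ≠ 0) (hQ : Irreducible Q)
    (hQm : Q.Monic) (hQroot : ∃ b : E, aeval b Q = 0) :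
    (∃ x : AdjoinRoot Q, aeval x P = 0) ↔ ∃ a ∈ P.aroots E, ∃ b ∈ Q.aroots E, a ∈ F⟮b⟯ := by
  haveI := Fact.mk hQ
  constructor
  · rintro ⟨x, hx⟩
    obtain ⟨b, hb⟩ := hQroot
    let φ : AdjoinRoot Q →ₐ[F] E :=
      AdjoinRoot.liftAlgHom Q (Algebra.ofId F E) b (by rwa [aeval_def] at hb)
    refine ⟨φ x, ?_, b, ?_, ?_⟩
    · rw [mem_aroots]
      exact ⟨hP0, by rw [aeval_algHom_apply, hx, map_zero]⟩
    · rw [mem_aroots]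
      exact ⟨hQ.ne_zero, hb⟩
    · induction x using AdjoinRoot.induction_on with
      | ih r =>
        rw [AdjoinRoot.liftAlgHom_mk]
        have hr : eval₂ (Algebra.ofId F E) b r = aeval b r := rfl
        rw [hr]
        exact algebra_adjoin_le_adjoin F {b} (Polynomial.aeval_mem_adjoin_singleton F b)
  · rintro ⟨a, ha, b, hb, hab⟩
    rw [mem_aroots] at ha hb
    have hbi : IsIntegral F b := ⟨Q, hQm, by rw [← aeval_def]; exact hb.2⟩
    have hmin : minpoly F b = Q := (minpoly.eq_of_irreducible_of_monic hQ hb.2 hQm).symm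
    let θ : F⟮b⟯ →ₐ[F] AdjoinRoot Q :=
      (AdjoinRoot.algHomOfDvd F (minpoly F b) Q (by rw [hmin])).comp
        (adjoinRootEquivAdjoin F hbi).symm.toAlgHom
    refine ⟨θ ⟨a, hab⟩, ?_⟩
    have h0 : aeval (⟨a, hab⟩ : F⟮b⟯) P = 0 := by
      have h1 : ((aeval (⟨a, hab⟩ : F⟮b⟯) P : F⟮b⟯) : E) = 0 := by
        rw [← IntermediateField.aeval_coe]; exact ha.2
      exact_mod_cast h1
    rw [aeval_algHom_apply, h0, map_zero]

open IntermediateField in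
/-- **Trager's criterion** (Trager 1976; Landau 1985, Thm. 1.4–1.5; Cohen 1993, §3.6.2, Lemma
3.6.2–3.6.3): let `Q` be monic irreducible separable, split in `E`, `P ≠ 0`, and let `N ∈ F[X]`
become, in `E[X]`, a nonzero constant times `∏_{P(a)=0} ∏_{Q(b)=0} (X − (a + c b))` (the norm from
`F(b)[X]` to `F[X]` of `P(X − c b)`, i.e. `Res_Y(Q(Y), P(X − cY))`). If `N` is separable
(squarefree), then some root of `P` lies in `F(b)` for some root `b` of `Q` iff `N` has an
irreducible factor of degree `≤ deg Q` — because the irreducible factors of `N` are the minimal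
polynomials of the `γ = a + c b`, and `F(γ) = F(a, b) ⊇ F(b)` by `mem_adjoin_simple_add_smul`.
[cite: Landau1985, §1 (Thm. 1.4–1.5, norms and factorization over ℚ(α))] [cite: Cohen1993, §3.6.2 (Lemmas 3.6.1–3.6.3, PDF pp. 193–194) and Prop. 4.5.3 (PDF p. 230)] -/
theorem exists_mem_adjoin_root_iff_exists_irreducible_dvd {P Q : F[X]} (hP0 : P ≠ 0)
    (hQ : Irreducible Q) (hQm : Q.Monic) (hQsep : Q.Separable)
    (hQs : (Q.map (algebraMap F E)).Splits) (c : F) {N : F[X]} {u : E} (hu : u ≠ 0)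
    (hN : N.map (algebraMap F E) =
      C u * (((P.aroots E) ×ˢ (Q.aroots E)).map fun ij => X - C (ij.1 + c • ij.2)).prod)
    (hNsep : N.Separable) :
    (∃ a ∈ P.aroots E, ∃ b ∈ Q.aroots E, a ∈ F⟮b⟯) ↔
      ∃ g : F[X], Irreducible g ∧ g ∣ N ∧ g.natDegree ≤ Q.natDegree := by
  classical
  have hQ0 : Q ≠ 0 := hQ.ne_zero
  -- degree of `F(b)` for a root `b` of `Q`
  have hb_int : ∀ b ∈ Q.aroots E, IsIntegral F b := fun b hb =>
    ⟨Q, hQm, by rw [← aeval_def]; exact ((mem_aroots).1 hb).2⟩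
  have hb_finrank : ∀ b ∈ Q.aroots E, Module.finrank F F⟮b⟯ = Q.natDegree := by
    intro b hb
    rw [adjoin.finrank (hb_int b hb), ← minpoly.eq_of_irreducible_of_monic hQ ((mem_aroots).1 hb).2 hQm]
  -- the pair sums are pairwise distinct
  set pairs := (P.aroots E) ×ˢ (Q.aroots E) with hpairs
  have hprod : (pairs.map fun ij => X - C (ij.1 + c • ij.2)) =
      (pairs.map fun ij => ij.1 + c • ij.2).map fun γ => X - C γ := by
    rw [Multiset.map_map]; rfl
  have hNE0 : N.map (algebraMap F E) ≠ 0 := map_ne_zero hNsep.ne_zero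
  have hnodup : (pairs.map fun ij => ij.1 + c • ij.2).Nodup := by
    have h1 := nodup_roots (hNsep.map (f := algebraMap F E))
    rwa [hN, roots_C_mul _ hu, hprod, roots_multiset_prod_X_sub_C] at h1
  have hinj := Multiset.inj_on_of_nodup_map hnodup
  -- evaluation of `N` at a point of `E`
  have hevalN : ∀ γ : E, aeval γ N = u * (pairs.map fun ij => γ - (ij.1 + c • ij.2)).prod := by
    intro γ
    rw [← eval_map_algebraMap, hN, eval_mul, eval_C, eval_multiset_prod, Multiset.map_map]
    have hmap : (pairs.map (eval γ ∘ fun ij => X - C (ij.1 + c • ij.2))) =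
        pairs.map fun ij => γ - (ij.1 + c • ij.2) :=
      Multiset.map_congr rfl fun ij _ => by simp
    rw [hmap]
  constructor
  · rintro ⟨a, ha, b, hb, hab⟩
    have ha_alg : IsAlgebraic F a := ⟨P, hP0, ((mem_aroots).1 ha).2⟩
    have hγ_int : IsIntegral F (a + c • b) := ha_alg.isIntegral.add ((hb_int b hb).smul c)
    refine ⟨minpoly F (a + c • b), minpoly.irreducible hγ_int, ?_, ?_⟩
    · apply minpoly.dvd
      rw [hevalN, Multiset.prod_eq_zero, mul_zero]
      exact Multiset.mem_map.2 ⟨(a, b), Multiset.mem_product.2 ⟨ha, hb⟩, by simp⟩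
    · rw [← adjoin.finrank hγ_int, ← hb_finrank b hb]
      haveI := adjoin.finiteDimensional (hb_int b hb)
      apply finrank_le_of_le_right
      rw [adjoin_simple_le_iff]
      exact F⟮b⟯.add_mem hab (F⟮b⟯.smul_mem (mem_adjoin_simple_self F b))
  · rintro ⟨g, hg, hgN, hgdeg⟩
    -- `g` has a root `γ` in `E`, which is a root of `N`, hence a pair sum `a + c b`
    have hNs : (N.map (algebraMap F E)).Splits := by
      rw [hN]
      refine (Splits.multisetProd fun f hf => ?_).C_mul u
      obtain ⟨ij, -, rfl⟩ := Multiset.mem_map.1 hf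
      exact Splits.X_sub_C _
    have hgs : (g.map (algebraMap F E)).Splits := hNs.of_dvd hNE0 (Polynomial.map_dvd (algebraMap F E) hgN)
    obtain ⟨γ, hγ⟩ : ∃ γ : E, (g.map (algebraMap F E)).eval γ = 0 :=
      hgs.exists_eval_eq_zero (by
        rw [degree_map]; exact (degree_pos_of_irreducible hg).ne')
    rw [eval_map_algebraMap] at hγ
    have hγN : aeval γ N = 0 := aeval_eq_zero_of_dvd_aeval_eq_zero hgN hγ
    rw [hevalN, mul_eq_zero, Multiset.prod_eq_zero_iff] at hγN
    obtain ⟨⟨a, b⟩, hab, hab0⟩ := Multiset.mem_map.1 (hγN.resolve_left hu)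
    obtain ⟨ha, hb⟩ := Multiset.mem_product.1 hab
    obtain rfl : γ = a + c • b := (sub_eq_zero.1 hab0)
    -- `b ∈ F(γ)` by the explicit primitive element lemma, so `F(b) ≤ F(γ)`
    have hbγ : b ∈ F⟮a + c • b⟯ := by
      refine mem_adjoin_simple_add_smul hP0 ((mem_aroots).1 ha).2 ((mem_aroots).1 hb).2 hQsep hQs c
        fun a' ha' b' hb' h => ?_
      have := hinj (a', b') (Multiset.mem_product.2 ⟨ha', hb'⟩) (a, b) hab h
      exact (Prod.mk.inj this).2
    -- degrees: `[F(γ):F] = deg g ≤ deg Q = [F(b):F]`, so `F(b) = F(γ) ∋ γ`, `a = γ - c b ∈ F(b)`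
    have hγ_alg : IsAlgebraic F (a + c • b) := ⟨g, hg.ne_zero, hγ⟩
    have hγ_int : IsIntegral F (a + c • b) := hγ_alg.isIntegral
    have hminγ : (minpoly F (a + c • b)).natDegree = g.natDegree := by
      rw [← minpoly.eq_of_irreducible hg hγ, natDegree_mul_C]
      exact inv_ne_zero (leadingCoeff_ne_zero.2 hg.ne_zero)
    haveI := adjoin.finiteDimensional hγ_int
    have heq : F⟮b⟯ = F⟮a + c • b⟯ := by
      apply eq_of_le_of_finrank_le (adjoin_simple_le_iff.2 hbγ)
      rw [adjoin.finrank hγ_int, hminγ, hb_finrank b hb]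
      exact hgdeg
    refine ⟨a, ha, b, hb, ?_⟩
    have hγb : a + c • b ∈ F⟮b⟯ := by rw [heq]; exact mem_adjoin_simple_self F _
    simpa using F⟮b⟯.sub_mem hγb (F⟮b⟯.smul_mem (mem_adjoin_simple_self F b) (x := c))

end Trager

/-! ### The criterion decided by the number-field isomorphism test (Landau 1985 / Cohen 1993) -/

section Criterion

open IntermediateField in
/-- **What the polynomial-time isomorphism test decides** (Landau 1985, Cor. to Thm. 2.1 via
Trager's norm method; Cohen 1993, Prop. 4.5.3 + Alg. 4.5.4 with Alg. 3.6.4): for monic irreducible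
`p, q ∈ ℤ[X]`, a rational `c`, a field `E ⊇ ℚ` in which `q` splits, and a separable (squarefree)
`N ∈ ℚ[X]` which over `E` is a nonzero constant times `∏_{p(a)=0} ∏_{q(b)=0} (X − (a + c b))`
(the norm polynomial `Res_Y(q(Y), p(X − cY))` computed by the algorithm), the number fields
`ℚ[X]/(p)` and `ℚ[X]/(q)` are isomorphic iff `deg p = deg q` and `N` has an irreducible factor
over `ℚ` of degree `≤ deg q`. (With `lll_monicIrreducible_mem_P`-style factoring of `N` over `ℤ`
this is the decision procedure behind `lenstra_numberFieldIso_mem_P`.)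
[cite: Landau1985, §1–2 (Thm. 1.4–1.5, Thm. 2.1 and the isomorphism corollary)] [cite: Cohen1993, Prop. 4.5.3, Alg. 4.5.4, §3.6.2] [cite: Lenstra1983, Thm. 3.7] -/
theorem nfIsomorphic_iff_exists_irreducible_dvd_norm {p q : ℤ[X]} (hp : p.Monic)
    (hpi : Irreducible p) (hq : q.Monic) (hqi : Irreducible q)
    {E : Type*} [Field E] [CharZero E] (hqs : (q.map (algebraMap ℤ E)).Splits) (c : ℚ)
    {N : ℚ[X]} {u : E} (hu : u ≠ 0)
    (hN : N.map (algebraMap ℚ E) =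
      C u * (((p.aroots E) ×ˢ (q.aroots E)).map fun ij => X - C (ij.1 + c • ij.2)).prod)
    (hNsep : N.Separable) :
    NFIsomorphic p q ↔ p.natDegree = q.natDegree ∧
      ∃ g : ℚ[X], Irreducible g ∧ g ∣ N ∧ g.natDegree ≤ q.natDegree := by
  set P := p.map (Int.castRingHom ℚ) with hPdef
  set Q := q.map (Int.castRingHom ℚ) with hQdef
  have hcomp : (algebraMap ℚ E).comp (Int.castRingHom ℚ) = algebraMap ℤ E := RingHom.ext_int _ _
  have hPmap : P.map (algebraMap ℚ E) = p.map (algebraMap ℤ E) := by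
    rw [hPdef, Polynomial.map_map, hcomp]
  have hQmap : Q.map (algebraMap ℚ E) = q.map (algebraMap ℤ E) := by
    rw [hQdef, Polynomial.map_map, hcomp]
  have hParoots : P.aroots E = p.aroots E := by rw [aroots_def, hPmap, aroots_def]
  have hQaroots : Q.aroots E = q.aroots E := by rw [aroots_def, hQmap, aroots_def]
  have hPi : Irreducible P := irreducible_map_rat_of_monic hp hpi
  have hQi : Irreducible Q := irreducible_map_rat_of_monic hq hqi
  have hQm : Q.Monic := hq.map _
  have hQsep : Q.Separable := hQi.separable
  have hQs' : (Q.map (algebraMap ℚ E)).Splits := by rwa [hQmap]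
  have hQdeg : Q.natDegree = q.natDegree := hq.natDegree_map _
  have hQroot : ∃ b : E, aeval b Q = 0 := by
    obtain ⟨b, hb⟩ := hQs'.exists_eval_eq_zero
      (by rw [degree_map]; exact (degree_pos_of_irreducible hQi).ne')
    exact ⟨b, by rwa [eval_map_algebraMap] at hb⟩
  have hN' : N.map (algebraMap ℚ E) =
      C u * (((P.aroots E) ×ˢ (Q.aroots E)).map fun ij => X - C (ij.1 + c • ij.2)).prod := by
    rw [hParoots, hQaroots]; exact hN
  rw [nfIsomorphic_iff hp hpi hq hqi, ← hPdef, ← hQdef,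
    exists_aeval_adjoinRoot_eq_zero_iff hPi.ne_zero hQi hQm hQroot,
    exists_mem_adjoin_root_iff_exists_irreducible_dvd hPi.ne_zero hQi hQm hQsep hQs' c hu hN' hNsep,
    hQdeg]

/-- **A good multiplier exists among `0, …, B` once `B` exceeds the number of "collisions"**: the
pair sums `a + c b` (`p(a) = 0`, `q(b) = 0`) are pairwise distinct for all but at most
`(deg p · deg q)²` values of `c`, so some `c ≤ (deg p · deg q)²` makes them distinct (Trager 1976,
Lemma; Cohen 1993, Lemma 3.6.2: "only finitely many `k` fail"; Landau 1985, Thm. 1.5). Stated for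
root multisets without repetitions in a field of characteristic zero. [cite: Cohen1993, §3.6.2 (Lemma 3.6.2)] [cite: Landau1985, §1 (Thm. 1.5)] -/
theorem exists_nodup_pairSums {E : Type*} [Field E] [CharZero E] (s t : Multiset E)
    (hs : s.Nodup) (ht : t.Nodup) :
    ∃ c : ℕ, c ≤ (Multiset.card s * Multiset.card t) ^ 2 ∧
      ((s ×ˢ t).map fun ij => ij.1 + (c : E) * ij.2).Nodup := by
  classical
  set B := (Multiset.card s * Multiset.card t) ^ 2 with hB
  -- the bad multipliers: for pairs `(a,b) ≠ (a',b')`, the (at most one) `c ≤ B` with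
  -- `a + c b = a' + c b'`; there are at most `|s × t|² ≤ B` of them
  let coll : (E × E) × (E × E) → ℕ → Prop := fun pp c =>
    pp.1 ≠ pp.2 ∧ pp.1.1 + (c : E) * pp.1.2 = pp.2.1 + (c : E) * pp.2.2
  let pairs : Finset (E × E) := (s ×ˢ t).toFinset
  let bad : Finset ℕ := (pairs ×ˢ pairs).biUnion fun pp => (Finset.range (B + 1)).filter (coll pp)
  have hbad1 : ∀ pp ∈ pairs ×ˢ pairs, ((Finset.range (B + 1)).filter (coll pp)).card ≤ 1 := by
    intro pp _
    refine Finset.card_le_one.2 fun c₁ hc₁ c₂ hc₂ => ?_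
    obtain ⟨hne, h₁⟩ := (Finset.mem_filter.1 hc₁).2
    obtain ⟨-, h₂⟩ := (Finset.mem_filter.1 hc₂).2
    by_contra hc
    have hcE : (c₁ : E) ≠ c₂ := fun h => hc (by exact_mod_cast h)
    have key : ((c₁ : E) - c₂) * (pp.1.2 - pp.2.2) = 0 := by linear_combination h₁ - h₂
    have hb : pp.1.2 = pp.2.2 :=
      sub_eq_zero.1 ((mul_eq_zero.1 key).resolve_left (sub_ne_zero.2 hcE))
    apply hne
    refine Prod.ext ?_ hb
    rw [hb] at h₁
    exact add_right_cancel h₁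
  have hcard_pairs : pairs.card ≤ Multiset.card s * Multiset.card t := by
    calc pairs.card ≤ Multiset.card (s ×ˢ t) := Multiset.toFinset_card_le _
      _ = Multiset.card s * Multiset.card t := Multiset.card_product _ _
  have hbad : bad.card ≤ B := by
    calc bad.card ≤ ∑ pp ∈ pairs ×ˢ pairs, ((Finset.range (B + 1)).filter (coll pp)).card :=
          Finset.card_biUnion_le
      _ ≤ ∑ _pp ∈ pairs ×ˢ pairs, 1 := Finset.sum_le_sum hbad1
      _ = pairs.card * pairs.card := by rw [Finset.sum_const, smul_eq_mul, mul_one, Finset.card_product]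
      _ ≤ B := by rw [hB, sq]; exact Nat.mul_le_mul hcard_pairs hcard_pairs
  -- so some `c ≤ B` is good
  obtain ⟨c, hc, hcbad⟩ : ∃ c ∈ Finset.range (B + 1), c ∉ bad := by
    by_contra h
    have hsub : Finset.range (B + 1) ⊆ bad := fun c hc => by
      by_contra hc'
      exact h ⟨c, hc, hc'⟩
    have := Finset.card_le_card hsub
    rw [Finset.card_range] at this
    omega
  refine ⟨c, Nat.lt_succ_iff.1 (Finset.mem_range.1 hc), ?_⟩
  -- distinctness of the pair sums for this `c`
  refine (Multiset.nodup_map_iff_inj_on (hs.product ht)).2 fun x hx y hy hxy => ?_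
  by_contra hne
  exact hcbad (Finset.mem_biUnion.2 ⟨(x, y),
    Finset.mem_product.2 ⟨Multiset.mem_toFinset.2 hx, Multiset.mem_toFinset.2 hy⟩,
    Finset.mem_filter.2 ⟨hc, hne, hxy⟩⟩)

/-- **Separability of the norm polynomial = distinctness of the pair sums**: if `N ∈ F[X]` is,
over `E`, a nonzero constant times `∏ (X − (a + c b))` over a multiset `m` of pairs, then `N` is
separable (squarefree; the algorithm tests `Res(N, N') ≠ 0`) iff the `a + c b` are pairwise
distinct — the hypothesis of `exists_mem_adjoin_root_iff_exists_irreducible_dvd`, guaranteed for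
some `c ≤ |m|²` by `exists_nodup_pairSums`. [cite: Cohen1993, §3.6.2 (Lemma 3.6.2: squarefree norm)] -/
theorem separable_iff_nodup_pairSums {F E : Type*} [Field F] [Field E] [Algebra F E]
    {N : F[X]} {u : E} (hu : u ≠ 0) (m : Multiset (E × E)) (c : F)
    (hN : N.map (algebraMap F E) = C u * (m.map fun ij => X - C (ij.1 + c • ij.2)).prod) :
    N.Separable ↔ (m.map fun ij => ij.1 + c • ij.2).Nodup := by
  have hprod : (m.map fun ij => X - C (ij.1 + c • ij.2)) =
      (m.map fun ij => ij.1 + c • ij.2).map fun γ => X - C γ := by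
    rw [Multiset.map_map]; rfl
  have hsplit : (N.map (algebraMap F E)).Splits := by
    rw [hN]
    refine (Splits.multisetProd fun f hf => ?_).C_mul u
    obtain ⟨ij, -, rfl⟩ := Multiset.mem_map.1 hf
    exact Splits.X_sub_C _
  have hne : N.map (algebraMap F E) ≠ 0 := by
    rw [hN, hprod]
    exact mul_ne_zero (C_ne_zero.2 hu) (monic_multisetProd_X_sub_C _).ne_zero
  rw [← separable_map (algebraMap F E), ← nodup_roots_iff_of_splits hne hsplit, hN, roots_C_mul _ hu,
    hprod, roots_multiset_prod_X_sub_C]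

/-- **The norm polynomial pointwise, as the integer resultant the machine computes** (Cohen 1993,
§3.6.2 / Alg. 3.6.4 step 2; Landau 1985, §1: `Norm(p(X − cβ)) = Res_Y(q(Y), p(X − cY))`): for monic
`p, q ∈ ℤ[X]` split in `E` and integers `c, x₀`, the resultant (with formal degrees `deg q`,
`deg p`) of `q(Y)` and `p(x₀ − cY) ∈ ℤ[Y]` is, in `E`, the value at `x₀` of
`∏_{p(a)=0} ∏_{q(b)=0} (X − (a + c b))`. Interpolating at `deg p · deg q + 1` integer points gives
the hypothesis `hN` of `nfIsomorphic_iff_exists_irreducible_dvd_norm` (with `u = 1`).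
[cite: Cohen1993, §3.6.2, Alg. 3.6.4 step 3 (PDF p. 195: `N(X) ← R_Y(T(Y), G(X − kY, Y))`)] [cite: Landau1985, §1 (Thm. 1.4)] -/
theorem algebraMap_resultant_comp_eq_prod_pairSums {p q : ℤ[X]} (hp : p.Monic) (hq : q.Monic)
    {E : Type*} [Field E] [CharZero E] (hps : (p.map (algebraMap ℤ E)).Splits)
    (hqs : (q.map (algebraMap ℤ E)).Splits) (c x₀ : ℤ) :
    algebraMap ℤ E (resultant q (p.comp (C x₀ - C c * X)) q.natDegree p.natDegree) =
      (((p.aroots E) ×ˢ (q.aroots E)).map fun ij => (x₀ : E) - (ij.1 + (c : E) * ij.2)).prod := by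
  set φ := algebraMap ℤ E with hφ
  have hqm : (q.map φ).Monic := hq.map φ
  have hpm : (p.map φ).Monic := hp.map φ
  have hdeg : ((p.comp (C x₀ - C c * X)).map φ).natDegree ≤ p.natDegree := by
    rw [Polynomial.map_comp]
    refine (natDegree_comp_le).trans ?_
    rw [hp.natDegree_map]
    rcases eq_or_ne c 0 with rfl | hc
    · simp
    · have h1 : ((C x₀ - C c * X : ℤ[X]).map φ).natDegree ≤ 1 := by
        rw [Polynomial.map_sub, Polynomial.map_mul, map_C, map_C, map_X]
        compute_degree!
      calc p.natDegree * ((C x₀ - C c * X : ℤ[X]).map φ).natDegree ≤ p.natDegree * 1 :=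
            Nat.mul_le_mul_left _ h1
        _ = p.natDegree := mul_one _
  rw [← resultant_map_map, ← hq.natDegree_map φ, resultant_eq_prod_eval _ _ _ hdeg hqs, hqm.leadingCoeff,
    one_pow, one_mul, Multiset.prod_map_product_eq_prod_prod, Multiset.prod_map_prod_map]
  refine congrArg _ (Multiset.map_congr rfl fun b _ => ?_)
  rw [Polynomial.map_comp, eval_comp, Polynomial.map_sub, Polynomial.map_mul, map_C, map_C, map_X,
    eval_sub, eval_mul, eval_C, eval_C, eval_X, hps.eval_eq_prod_roots_of_monic hpm]
  refine congrArg _ (Multiset.map_congr rfl fun a _ => ?_)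
  simp only [hφ, algebraMap_int_eq, eq_intCast]
  ring

/-- **The norm polynomial from its integer values** (interpolation form of `hN`): if `N ∈ ℤ[X]` has
degree `≤ deg p · deg q` and takes at `x₀ = 0, 1, …, deg p · deg q` the resultant values
`Res_Y(q(Y), p(x₀ − cY))`, then over any field `E ⊇ ℚ` splitting `p` and `q`,
`N = ∏_{p(a)=0} ∏_{q(b)=0} (X − (a + c b))` — the hypothesis `hN` (with `u = 1`) of
`nfIsomorphic_iff_exists_irreducible_dvd_norm`. [cite: Cohen1993, §3.6.2, Alg. 3.6.4 step 3 (PDF p. 195)] -/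
theorem map_eq_prod_pairSums_of_eval_eq_resultant {p q : ℤ[X]} (hp : p.Monic) (hq : q.Monic)
    {E : Type*} [Field E] [CharZero E] (hps : (p.map (algebraMap ℤ E)).Splits)
    (hqs : (q.map (algebraMap ℤ E)).Splits) (c : ℤ) {N : ℤ[X]}
    (hNdeg : N.natDegree ≤ p.natDegree * q.natDegree)
    (hNeval : ∀ x₀ : ℕ, x₀ ≤ p.natDegree * q.natDegree →
      N.eval (x₀ : ℤ) = resultant q (p.comp (C (x₀ : ℤ) - C c * X)) q.natDegree p.natDegree) :
    N.map (algebraMap ℤ E) =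
      (((p.aroots E) ×ˢ (q.aroots E)).map fun ij => X - C (ij.1 + (c : ℚ) • ij.2)).prod := by
  classical
  set B := p.natDegree * q.natDegree with hB
  set pairs := (p.aroots E) ×ˢ (q.aroots E) with hpairs
  have hcard : Multiset.card pairs = B := by
    rw [hpairs, Multiset.card_product, aroots_def, aroots_def, ← hps.natDegree_eq_card_roots,
      ← hqs.natDegree_eq_card_roots, hp.natDegree_map, hq.natDegree_map]
  have hsmul : ∀ ij : E × E, ij.1 + (c : ℚ) • ij.2 = ij.1 + (c : E) * ij.2 := fun ij => by
    rw [Rat.smul_def, Rat.cast_intCast]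
  -- the two sides have degree `≤ B` and agree at the `B + 1` points `0, …, B`
  let pts : Finset E := (Finset.range (B + 1)).image fun k : ℕ => (k : E)
  have hpts : pts.card = B + 1 := by
    simp only [pts]
    rw [Finset.card_image_of_injective _ Nat.cast_injective, Finset.card_range]
  apply eq_of_degrees_lt_of_eval_finset_eq pts
  · rw [hpts]
    refine (degree_map_le).trans_lt ?_
    exact (degree_le_natDegree.trans (WithBot.coe_le_coe.2 hNdeg)).trans_lt
      (WithBot.coe_lt_coe.2 (Nat.lt_succ_self B))
  · rw [hpts]
    refine (degree_multiset_prod_le _).trans_lt ?_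
    rw [Multiset.map_map]
    have hle : (pairs.map (degree ∘ fun ij => X - C (ij.1 + (c : ℚ) • ij.2))).sum ≤ (B : WithBot ℕ) := by
      have h1 : ∀ d ∈ pairs.map (degree ∘ fun ij : E × E => X - C (ij.1 + (c : ℚ) • ij.2)), d ≤ 1 :=
        fun d hd => by
          obtain ⟨ij, -, rfl⟩ := Multiset.mem_map.1 hd
          exact degree_X_sub_C_le _
      refine (Multiset.sum_le_card_nsmul _ _ h1).trans ?_
      rw [Multiset.card_map, hcard, nsmul_one]
    exact hle.trans_lt (WithBot.coe_lt_coe.2 (Nat.lt_succ_self B))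
  · intro x hx
    obtain ⟨k, hk, rfl⟩ := Finset.mem_image.1 hx
    have hkB : k ≤ B := Nat.lt_succ_iff.1 (Finset.mem_range.1 hk)
    have h1 : (N.map (algebraMap ℤ E)).eval (k : E) = algebraMap ℤ E (N.eval (k : ℤ)) := by
      rw [eval_map, eval₂_at_natCast]
    rw [h1, hNeval k hkB, algebraMap_resultant_comp_eq_prod_pairSums hp hq hps hqs c k,
      eval_multiset_prod, Multiset.map_map]
    refine congrArg _ (Multiset.map_congr rfl fun ij _ => ?_)
    simp [hsmul]

/-- **The isomorphism test in integer terms (soundness)** — Landau 1985 / Cohen 1993 Alg. 4.5.4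
read through Trager's norm: for monic irreducible `p, q ∈ ℤ[X]`, an integer multiplier `c`, and the
integer polynomial `N` of degree `≤ deg p · deg q` interpolating the resultants
`Res_Y(q(Y), p(x₀ − cY))` at `x₀ = 0, …, deg p · deg q`: if `N` is squarefree over `ℚ` (separable;
`Res(N, N') ≠ 0`), then `ℚ[X]/(p) ≃ ℚ[X]/(q)` iff `deg p = deg q` and `N` has an irreducible factor
over `ℚ` of degree `≤ deg q`. No field `E` appears: the statement is about integer data computable
in polynomial time (resultants = integer determinants; factoring `N` by [LLL82, §3]).
[cite: Landau1985, §2 (Thm. 2.1 and Cor.: isomorphism in polynomial time)] [cite: Cohen1993, Alg. 4.5.4 with Alg. 3.6.4] [cite: Lenstra1983, Thm. 3.7] -/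
theorem nfIsomorphic_iff_of_norm_values {p q : ℤ[X]} (hp : p.Monic) (hpi : Irreducible p)
    (hq : q.Monic) (hqi : Irreducible q) (c : ℤ) {N : ℤ[X]}
    (hNdeg : N.natDegree ≤ p.natDegree * q.natDegree)
    (hNeval : ∀ x₀ : ℕ, x₀ ≤ p.natDegree * q.natDegree →
      N.eval (x₀ : ℤ) = resultant q (p.comp (C (x₀ : ℤ) - C c * X)) q.natDegree p.natDegree)
    (hNsep : (N.map (Int.castRingHom ℚ)).Separable) :
    NFIsomorphic p q ↔ p.natDegree = q.natDegree ∧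
      ∃ g : ℚ[X], Irreducible g ∧ g ∣ N.map (Int.castRingHom ℚ) ∧ g.natDegree ≤ q.natDegree := by
  let E := AlgebraicClosure ℚ
  have hps : (p.map (algebraMap ℤ E)).Splits := IsAlgClosed.splits _
  have hqs : (q.map (algebraMap ℤ E)).Splits := IsAlgClosed.splits _
  have hcomp : (algebraMap ℚ E).comp (Int.castRingHom ℚ) = algebraMap ℤ E := RingHom.ext_int _ _
  have hN : (N.map (Int.castRingHom ℚ)).map (algebraMap ℚ E) = C (1 : E) *
      (((p.aroots E) ×ˢ (q.aroots E)).map fun ij => X - C (ij.1 + (c : ℚ) • ij.2)).prod := by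
    rw [Polynomial.map_map, hcomp, C_1, one_mul]
    exact map_eq_prod_pairSums_of_eval_eq_resultant hp hq hps hqs c hNdeg hNeval
  exact nfIsomorphic_iff_exists_irreducible_dvd_norm hp hpi hq hqi hqs (c : ℚ) one_ne_zero hN hNsep

/-- **The isomorphism test in integer terms (completeness of the multiplier search)**: some
`c ≤ (deg p · deg q)²` makes the interpolated norm polynomial `N_c` squarefree over `ℚ`, so the
loop `c = 0, 1, …, (deg p · deg q)²` of the algorithm reaches a `c` to which
`nfIsomorphic_iff_of_norm_values` applies (Cohen 1993, Lemma 3.6.2 / Alg. 3.6.4 step 1: "only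
finitely many `k`" fail; here with the explicit polynomial bound). [cite: Cohen1993, §3.6.2 (Lemma 3.6.2, Alg. 3.6.4)] [cite: Landau1985, §1 (Thm. 1.5)] -/
theorem exists_multiplier_norm_separable {p q : ℤ[X]} (hp : p.Monic) (hpi : Irreducible p)
    (hq : q.Monic) (hqi : Irreducible q) :
    ∃ c : ℕ, c ≤ (p.natDegree * q.natDegree) ^ 2 ∧ ∀ N : ℤ[X],
      N.natDegree ≤ p.natDegree * q.natDegree →
      (∀ x₀ : ℕ, x₀ ≤ p.natDegree * q.natDegree →
        N.eval (x₀ : ℤ) = resultant q (p.comp (C (x₀ : ℤ) - C (c : ℤ) * X)) q.natDegree p.natDegree) →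
      (N.map (Int.castRingHom ℚ)).Separable := by
  let E := AlgebraicClosure ℚ
  have hps : (p.map (algebraMap ℤ E)).Splits := IsAlgClosed.splits _
  have hqs : (q.map (algebraMap ℤ E)).Splits := IsAlgClosed.splits _
  have hcomp : (algebraMap ℚ E).comp (Int.castRingHom ℚ) = algebraMap ℤ E := RingHom.ext_int _ _
  -- the roots of `p` and of `q` in `E` are simple (irreducible over `ℚ`, characteristic zero)
  have hnodup : ∀ {r : ℤ[X]}, r.Monic → Irreducible r → (r.aroots E).Nodup := by
    intro r hr hri
    have hsep : (r.map (Int.castRingHom ℚ)).Separable := (irreducible_map_rat_of_monic hr hri).separable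
    have h := nodup_roots (hsep.map (f := algebraMap ℚ E))
    rwa [Polynomial.map_map, hcomp] at h
  have hcardp : Multiset.card (p.aroots E) = p.natDegree := by
    rw [aroots_def, ← hps.natDegree_eq_card_roots, hp.natDegree_map]
  have hcardq : Multiset.card (q.aroots E) = q.natDegree := by
    rw [aroots_def, ← hqs.natDegree_eq_card_roots, hq.natDegree_map]
  obtain ⟨c, hc, hcnodup⟩ := exists_nodup_pairSums (p.aroots E) (q.aroots E) (hnodup hp hpi) (hnodup hq hqi)
  rw [hcardp, hcardq] at hc
  refine ⟨c, hc, fun N hNdeg hNeval => ?_⟩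
  have hN : (N.map (Int.castRingHom ℚ)).map (algebraMap ℚ E) = C (1 : E) *
      (((p.aroots E) ×ˢ (q.aroots E)).map fun ij => X - C (ij.1 + ((c : ℤ) : ℚ) • ij.2)).prod := by
    rw [Polynomial.map_map, hcomp, C_1, one_mul]
    exact map_eq_prod_pairSums_of_eval_eq_resultant hp hq hps hqs c hNdeg hNeval
  rw [separable_iff_nodup_pairSums one_ne_zero _ _ hN]
  convert hcnodup using 2
  rw [Rat.smul_def, Int.cast_natCast, Rat.cast_natCast]

end Criterion

end Literature.Computability.Complexity
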